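import Literature.NumberTheory.DiophantineApproximation.DilogHermitePadeRational
import Literature.NumberTheory.DiophantineApproximation.DilogHermitePadeArithmetic
import Mathlib.Algebra.Order.Field.Basic
import HarnessLib

/-!
# Hermite–Padé forms for `1, Li₁, Li₂` at `M/N` — integrality and size of the coefficients

Topic `Literature/NumberTheory/DiophantineApproximation`. For the coefficients
`formAQ n N M ∈ ℤ`, `formBQ n N M`, `formCQ n N M ∈ ℚ` of `M^n S_n(M/N)` (vocabulary in
`DilogHermitePadeRational.lean`; at `M = 1` they are the `formA`, `formB`, `formC` of
`DilogHermitePade.lean`) we prove, exactly as in the case `M = 1`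
(`DilogHermitePadeArithmetic.lean`),

* integrality: `D_n · formBQ ∈ ℤ` and `D_n · formCQ ∈ ℤ` for the common denominator
  `D_n = denom n = lcm(1..3n) · lcm(1..n)²` (`isInt_denom_mul_formBQ`, `isInt_denom_mul_formCQ`);
* sizes: for `1 ≤ M ≤ N` and `n ≥ 1` all three are at most `10 n³ 2^{7n} N^n` in absolute value
  (`abs_formAQ_le`, `abs_formBQ_le`, `abs_formCQ_le`), through `N^i M^{n−i} ≤ N^n`.

Reference: S. David, N. Hirata-Kohno, M. Kawashima, *Can polylogarithms at algebraic points be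
linearly independent?*, Moscow J. Comb. Number Th. 9 (2020), Thm 2.1.
-/

noncomputable section

open Finset

namespace Literature.NumberTheory.DiophantineApproximation

namespace DilogPade

/-! ### Integrality -/

/-- **Integrality of `b^ℚ_n`**: `D_n · formBQ n N M ∈ ℤ` with `D_n = lcm(1..3n) · lcm(1..n)²`
(`lcm(1..3n) B_{n,i} ∈ ℤ`, the other factors are integers).
[cite: DavidHirataKohnoKawashima2020, Thm 2.1] -/
theorem isInt_denom_mul_formBQ (n N M : ℕ) : ∃ z : ℤ, (denom n : ℚ) * formBQ n N M = z := by
  rw [formBQ, mul_sum]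
  refine isInt_sum _ _ fun i hi => ?_
  have hi' : i ≤ n := Nat.lt_succ_iff.1 (mem_range.1 hi)
  obtain ⟨z, hz⟩ := isInt_lcmUpto_mul_coefB hi'
  refine ⟨z * (Nat.lcmUpto n : ℤ) ^ 2 * (N : ℤ) ^ i * (M : ℤ) ^ (n - i), ?_⟩
  rw [denom]
  push_cast
  rw [← hz]
  ring

/-- **Integrality of `c^ℚ_n`**: `D_n · formCQ n N M ∈ ℤ` with `D_n = lcm(1..3n) · lcm(1..n)²`
(`(i − k)² ∣ lcm(1..n)²` for the `A`-terms, `lcm(1..3n) B_{n,i} ∈ ℤ` and `(i − k) ∣ lcm(1..n)` for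
the `B`-terms, `1 ≤ i − k ≤ n`; the factors `N^k M^{n−k}` are integers).
[cite: DavidHirataKohnoKawashima2020, Thm 2.1] -/
theorem isInt_denom_mul_formCQ (n N M : ℕ) : ∃ z : ℤ, (denom n : ℚ) * formCQ n N M = z := by
  rw [formCQ, mul_neg, mul_sum]
  refine isInt_neg (isInt_sum _ _ fun i hi => ?_)
  rw [mul_sum]
  refine isInt_sum _ _ fun k hk => ?_
  have hi' : i ≤ n := Nat.lt_succ_iff.1 (mem_range.1 hi)
  have hk' : k < i := mem_range.1 hk
  obtain ⟨z, hz⟩ := isInt_lcmUpto_mul_coefB hi'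
  obtain ⟨w, hw⟩ : ∃ w : ℤ, (Nat.lcmUpto n : ℚ) / ((i : ℚ) - k) = w := by
    have e : (i : ℚ) - k = (((i : ℤ) - k : ℤ) : ℚ) := by push_cast; ring
    rw [e]
    exact isInt_natCast_div (intCast_sub_dvd_lcmUpto (by omega) hi' (by omega))
  refine ⟨(N : ℤ) ^ k * (M : ℤ) ^ (n - k) *
    ((coefA n i : ℤ) * (Nat.lcmUpto (3 * n) : ℤ) * w * w + z * (Nat.lcmUpto n : ℤ) * w), ?_⟩
  rw [denom]
  push_cast
  rw [← hz, ← hw]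
  generalize (i : ℚ) - k = d
  ring

/-! ### Sizes of the coefficients -/

/-- `N^i · M^{n−i} ≤ N^n` for naturals `M ≤ N` and `i ≤ n`. [folklore] -/
theorem pow_mul_pow_sub_le_pow {N M n i : ℕ} (hMN : M ≤ N) (hi : i ≤ n) :
    N ^ i * M ^ (n - i) ≤ N ^ n :=
  calc N ^ i * M ^ (n - i) ≤ N ^ i * N ^ (n - i) :=
        Nat.mul_le_mul_left _ (Nat.pow_le_pow_left hMN _)
    _ = N ^ n := pow_mul_pow_sub N hi

/-- `|a^ℚ_n| ≤ (n+1) 2^{7n} N^n ≤ 10 n³ 2^{7n} N^n` for `n ≥ 1` and `1 ≤ M ≤ N`.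
[cite: DavidHirataKohnoKawashima2020, Thm 2.1] -/
theorem abs_formAQ_le {n N M : ℕ} (hn : 1 ≤ n) (hM : 1 ≤ M) (hMN : M ≤ N) :
    |(formAQ n N M : ℝ)| ≤ 10 * (n : ℝ) ^ 3 * 2 ^ (7 * n) * (N : ℝ) ^ n := by
  have hn' : (1 : ℝ) ≤ n := by exact_mod_cast hn
  have hterm : ∀ i ∈ range (n + 1),
      ((coefA n i : ℕ) : ℝ) * (N : ℝ) ^ i * (M : ℝ) ^ (n - i) ≤ 2 ^ (7 * n) * (N : ℝ) ^ n := by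
    intro i hi
    have hi' : i ≤ n := Nat.lt_succ_iff.1 (mem_range.1 hi)
    have hA : ((coefA n i : ℕ) : ℝ) ≤ 2 ^ (7 * n) := by exact_mod_cast coefA_le hi'
    have hpow : (N : ℝ) ^ i * (M : ℝ) ^ (n - i) ≤ (N : ℝ) ^ n := by
      exact_mod_cast pow_mul_pow_sub_le_pow hMN hi'
    rw [mul_assoc]
    exact mul_le_mul hA hpow (by positivity) (by positivity)
  have hcast : (formAQ n N M : ℝ) =
      ∑ i ∈ range (n + 1), ((coefA n i : ℕ) : ℝ) * (N : ℝ) ^ i * (M : ℝ) ^ (n - i) := by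
    push_cast [formAQ]
    rfl
  rw [hcast, abs_of_nonneg (sum_nonneg fun i _ => by positivity)]
  calc ∑ i ∈ range (n + 1), ((coefA n i : ℕ) : ℝ) * (N : ℝ) ^ i * (M : ℝ) ^ (n - i)
      ≤ ∑ _i ∈ range (n + 1), 2 ^ (7 * n) * (N : ℝ) ^ n := sum_le_sum hterm
    _ = ((n : ℝ) + 1) * (2 ^ (7 * n) * (N : ℝ) ^ n) := by simp
    _ ≤ 10 * (n : ℝ) ^ 3 * (2 ^ (7 * n) * (N : ℝ) ^ n) := by
        apply mul_le_mul_of_nonneg_right _ (by positivity)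
        have hn2 : (n : ℝ) ≤ (n : ℝ) ^ 2 := by nlinarith
        have hn3 : (n : ℝ) ^ 2 ≤ (n : ℝ) ^ 3 := by nlinarith
        nlinarith
    _ = 10 * (n : ℝ) ^ 3 * 2 ^ (7 * n) * (N : ℝ) ^ n := by ring

/-- `|b^ℚ_n| ≤ (n+1) · 4n · 2^{7n} N^n ≤ 10 n³ 2^{7n} N^n` for `n ≥ 1` and `1 ≤ M ≤ N`.
[cite: DavidHirataKohnoKawashima2020, Thm 2.1] -/
theorem abs_formBQ_le {n N M : ℕ} (hn : 1 ≤ n) (hM : 1 ≤ M) (hMN : M ≤ N) :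
    |((formBQ n N M : ℚ) : ℝ)| ≤ 10 * (n : ℝ) ^ 3 * 2 ^ (7 * n) * (N : ℝ) ^ n := by
  have key : |formBQ n N M| ≤ 10 * (n : ℚ) ^ 3 * 2 ^ (7 * n) * (N : ℚ) ^ n := by
    have hn' : (1 : ℚ) ≤ n := by exact_mod_cast hn
    calc |formBQ n N M|
        ≤ ∑ i ∈ range (n + 1), |coefB n i * (N : ℚ) ^ i * (M : ℚ) ^ (n - i)| :=
          abs_sum_le_sum_abs _ _
      _ ≤ ∑ _i ∈ range (n + 1), 4 * n * 2 ^ (7 * n) * (N : ℚ) ^ n := by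
        refine sum_le_sum fun i hi => ?_
        have hi' : i ≤ n := Nat.lt_succ_iff.1 (mem_range.1 hi)
        have hpow : (N : ℚ) ^ i * (M : ℚ) ^ (n - i) ≤ (N : ℚ) ^ n := by
          exact_mod_cast pow_mul_pow_sub_le_pow hMN hi'
        have h0 : (0 : ℚ) ≤ (N : ℚ) ^ i * (M : ℚ) ^ (n - i) := by positivity
        rw [mul_assoc, abs_mul, abs_of_nonneg h0]
        exact mul_le_mul (abs_coefB_le hi') hpow h0 (by positivity)
      _ = ((n : ℚ) + 1) * (4 * n * 2 ^ (7 * n) * (N : ℚ) ^ n) := by simp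
      _ ≤ 10 * (n : ℚ) ^ 3 * 2 ^ (7 * n) * (N : ℚ) ^ n := by
        have h1 : ((n : ℚ) + 1) * (4 * n) ≤ 10 * (n : ℚ) ^ 3 := by
          have hn2 : (n : ℚ) ≤ (n : ℚ) ^ 2 := by nlinarith
          have hn3 : (n : ℚ) ^ 2 ≤ (n : ℚ) ^ 3 := by nlinarith
          nlinarith
        have h2 : (0 : ℚ) ≤ 2 ^ (7 * n) * (N : ℚ) ^ n := by positivity
        calc ((n : ℚ) + 1) * (4 * n * 2 ^ (7 * n) * (N : ℚ) ^ n)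
            = ((n : ℚ) + 1) * (4 * n) * (2 ^ (7 * n) * (N : ℚ) ^ n) := by ring
          _ ≤ 10 * (n : ℚ) ^ 3 * (2 ^ (7 * n) * (N : ℚ) ^ n) :=
              mul_le_mul_of_nonneg_right h1 h2
          _ = _ := by ring
  exact_mod_cast key

/-- `|c^ℚ_n| ≤ (n+1) · n · (1 + 4n) · 2^{7n} N^n ≤ 10 n³ 2^{7n} N^n` for `n ≥ 1` and `1 ≤ M ≤ N`
(each `1/(i−k)^s ≤ 1` and `N^k M^{n−k} ≤ N^n`). [cite: DavidHirataKohnoKawashima2020, Thm 2.1] -/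
theorem abs_formCQ_le {n N M : ℕ} (hn : 1 ≤ n) (hM : 1 ≤ M) (hMN : M ≤ N) :
    |((formCQ n N M : ℚ) : ℝ)| ≤ 10 * (n : ℝ) ^ 3 * 2 ^ (7 * n) * (N : ℝ) ^ n := by
  have key : |formCQ n N M| ≤ 10 * (n : ℚ) ^ 3 * 2 ^ (7 * n) * (N : ℚ) ^ n := by
    have hn' : (1 : ℚ) ≤ n := by exact_mod_cast hn
    have hterm : ∀ i ∈ range (n + 1), ∀ k ∈ range i,
        |(N : ℚ) ^ k * (M : ℚ) ^ (n - k) *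
            ((coefA n i : ℚ) / ((i : ℚ) - k) ^ 2 + coefB n i / ((i : ℚ) - k))| ≤
          (N : ℚ) ^ n * (2 ^ (7 * n) + 4 * n * 2 ^ (7 * n)) := by
      intro i hi k hk
      have hi' : i ≤ n := Nat.lt_succ_iff.1 (mem_range.1 hi)
      have hk' : k < i := mem_range.1 hk
      have hkn : k ≤ n := by omega
      have hd : (1 : ℚ) ≤ (i : ℚ) - k := by
        have : (k : ℚ) + 1 ≤ i := by exact_mod_cast hk'
        linarith
      have hd0 : (0 : ℚ) < (i : ℚ) - k := by linarith
      have hA : ((coefA n i : ℕ) : ℚ) ≤ 2 ^ (7 * n) := by exact_mod_cast coefA_le hi'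
      have h1 : |(coefA n i : ℚ) / ((i : ℚ) - k) ^ 2| ≤ 2 ^ (7 * n) := by
        rw [abs_div, Nat.abs_cast, abs_pow, abs_of_pos hd0]
        exact (div_le_self (by positivity) (one_le_pow₀ hd)).trans hA
      have h2 : |coefB n i / ((i : ℚ) - k)| ≤ 4 * n * 2 ^ (7 * n) := by
        rw [abs_div, abs_of_pos hd0]
        exact (div_le_self (abs_nonneg _) hd).trans (abs_coefB_le hi')
      have hpow : (N : ℚ) ^ k * (M : ℚ) ^ (n - k) ≤ (N : ℚ) ^ n := by
        exact_mod_cast pow_mul_pow_sub_le_pow hMN hkn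
      have h0 : (0 : ℚ) ≤ (N : ℚ) ^ k * (M : ℚ) ^ (n - k) := by positivity
      rw [abs_mul, abs_of_nonneg h0]
      exact mul_le_mul hpow ((abs_add_le _ _).trans (add_le_add h1 h2)) (abs_nonneg _)
        (by positivity)
    have hT0 : (0 : ℚ) ≤ (N : ℚ) ^ n * (2 ^ (7 * n) + 4 * n * 2 ^ (7 * n)) := by positivity
    rw [formCQ, abs_neg]
    calc |∑ i ∈ range (n + 1), ∑ k ∈ range i, (N : ℚ) ^ k * (M : ℚ) ^ (n - k) *
            ((coefA n i : ℚ) / ((i : ℚ) - k) ^ 2 + coefB n i / ((i : ℚ) - k))|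
        ≤ ∑ i ∈ range (n + 1), |∑ k ∈ range i, (N : ℚ) ^ k * (M : ℚ) ^ (n - k) *
            ((coefA n i : ℚ) / ((i : ℚ) - k) ^ 2 + coefB n i / ((i : ℚ) - k))| :=
          abs_sum_le_sum_abs _ _
      _ ≤ ∑ i ∈ range (n + 1), ∑ k ∈ range i, |(N : ℚ) ^ k * (M : ℚ) ^ (n - k) *
            ((coefA n i : ℚ) / ((i : ℚ) - k) ^ 2 + coefB n i / ((i : ℚ) - k))| :=
          sum_le_sum fun i _ => abs_sum_le_sum_abs _ _
      _ ≤ ∑ i ∈ range (n + 1), ∑ _k ∈ range i,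
            (N : ℚ) ^ n * (2 ^ (7 * n) + 4 * n * 2 ^ (7 * n)) :=
          sum_le_sum fun i hi => sum_le_sum fun k hk => hterm i hi k hk
      _ = ∑ i ∈ range (n + 1), (i : ℚ) * ((N : ℚ) ^ n * (2 ^ (7 * n) + 4 * n * 2 ^ (7 * n))) := by
          simp
      _ ≤ ∑ _i ∈ range (n + 1), (n : ℚ) * ((N : ℚ) ^ n * (2 ^ (7 * n) + 4 * n * 2 ^ (7 * n))) := by
          refine sum_le_sum fun i hi => ?_
          have : (i : ℚ) ≤ n := by exact_mod_cast Nat.lt_succ_iff.1 (mem_range.1 hi)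
          exact mul_le_mul_of_nonneg_right this hT0
      _ = ((n : ℚ) + 1) * ((n : ℚ) * ((N : ℚ) ^ n * (2 ^ (7 * n) + 4 * n * 2 ^ (7 * n)))) := by
          simp
      _ ≤ 10 * (n : ℚ) ^ 3 * 2 ^ (7 * n) * (N : ℚ) ^ n := by
          have h3 : ((n : ℚ) + 1) * n * (1 + 4 * n) ≤ 10 * (n : ℚ) ^ 3 := by
            have hn2 : (n : ℚ) ≤ (n : ℚ) ^ 2 := by nlinarith
            have hn3 : (n : ℚ) ^ 2 ≤ (n : ℚ) ^ 3 := by nlinarith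
            nlinarith
          have h2 : (0 : ℚ) ≤ 2 ^ (7 * n) * (N : ℚ) ^ n := by positivity
          calc ((n : ℚ) + 1) * ((n : ℚ) * ((N : ℚ) ^ n * (2 ^ (7 * n) + 4 * n * 2 ^ (7 * n))))
              = ((n : ℚ) + 1) * n * (1 + 4 * n) * (2 ^ (7 * n) * (N : ℚ) ^ n) := by ring
            _ ≤ 10 * (n : ℚ) ^ 3 * (2 ^ (7 * n) * (N : ℚ) ^ n) :=
                mul_le_mul_of_nonneg_right h3 h2
            _ = _ := by ring
  exact_mod_cast key

end DilogPade

end Literature.NumberTheory.DiophantineApproximation
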